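import Mathlib
import HarnessLib
import Summits.HubbardSuperconductivity.HubbardSuperconductivity.Theorems.KLProgrammeKLRegimeWickBubbleChannelPPGeneral
import Summits.HubbardSuperconductivity.HubbardSuperconductivity.Theorems.KLProgrammeKLRegimeWickBubbleChannelPH

/-!
# Route `KLProgramme` — crux K3, ENGINE child (gen 5 stmt-…-19918 / gen 6 stmt-…-20236 `KLRegimeEngineV16`), stub `stub_engine_step_values`,
# conjunct (E2-v10) at `1 ≤ n`: the two PARTICLE–HOLE channels at GENERAL external pair frequencies, for ANY conserving carrier —
# `bubbleSum_phDirect/phCrossed_pairKernel_of_conserving`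

Cell gate-hubbard-kl, seat hubbard-kl-k3c1-p1 (g6), technique «composed-map remainder propagation».  Sequel to `…WickBubbleChannelPPGeneral`
(p510766).  p1 g9's `bubbleSum_phDirect_pairLabels` / `bubbleSum_phCrossed_pairLabels` (p502214) read the two particle–hole channels of the two-line
term with both external pairs at `ω₀` and for `klWickAction … n`.  The continuous (E2) organisation needs them at general external pairs
`x = (k⃗, ω)` (incoming `(−ω,Q−k⃗)↓−, (ω,k⃗)↑−`), `y = (k⃗′, ω′)` (outgoing `(ω′,k⃗′)↑+, (−ω′,Q−k⃗′)↓+`) and for a carrier `W` known only through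
its four conservation selection rules (`hWq hWf hWs hWp`; instances: `klWickAction n` — p1's `…WickConservation` —, `𝒲_Λ` — `…WickScaleFlowConservation`).
At general frequencies BOTH channels carry a frequency transfer, so both are written as CONDITIONAL sums (the finite-`M` edge makes the partner
frequency index possibly absent):

* §1 selection at the ph leg strings: `kernel_ph_same_charge_of_conserving`; DIRECT vertex `((ω′,k⃗′)↑+, (ω,k⃗)↑−)`:
  `kernel_phd_eq_zero_of_not_of_conserving` — line ends `ψ̂⁻_{pσ}, ψ̂⁺_{p′σ′}` need `n(p′) + n(ω′) = n(p) + n(ω)`, `p⃗′ = p⃗ + k⃗ − k⃗′`, `σ′ = σ`;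
  CROSSED vertex `((ω′,k⃗′)↑+, (−ω,Q−k⃗)↓−)`: `kernel_phx_eq_zero_of_not_of_conserving` — `n(p′) + n(ω) + n(ω′) + 1 = n(p)`, `p⃗′ = p⃗ + Q − k⃗ − k⃗′`,
  `(σ,σ′) = (↑,↓)`;
* §2 **`bubbleSum_phDirect_pairKernel_of_conserving`**:
  `B(Z₀Z₃|Z₁Z₂) = −c₄⁻²·Σ_p Σ_σ Σ_{p′} [n(p′)+n(ω′) = n(p)+n(ω) ∧ p⃗′ = p⃗+k⃗−k⃗′]·(ℓ₂(p)ℓ₁(p′) + ℓ₁(p)ℓ₂(p′))·𝒱₄(W)(ψ̂⁻_{pσ},ψ̂⁺_{p′σ},Z₀,Z₃)·𝒱₄(W)(ψ̂⁺_{pσ},ψ̂⁻_{p′σ},Z₁,Z₂)`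
  — the direct loop at transfer `(ω − ω′, k⃗ − k⃗′)`;
* §3 **`bubbleSum_phCrossed_pairKernel_of_conserving`**:
  `B(Z₀Z₂|Z₁Z₃) = −c₄⁻²·Σ_p Σ_{p′} [n(p′)+n(ω)+n(ω′)+1 = n(p) ∧ p⃗′ = p⃗+Q−k⃗−k⃗′]·(ℓ₂(p)ℓ₁(p′) + ℓ₁(p)ℓ₂(p′))·𝒱₄(W)(ψ̂⁻_{p↑},ψ̂⁺_{p′↓},Z₀,Z₂)·𝒱₄(W)(ψ̂⁺_{p↑},ψ̂⁻_{p′↓},Z₁,Z₃)`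
  — the exchange loop at transfer `(ω + ω′ + 2π/β·…, k⃗ + k⃗′ − Q)` (E2-DRIVE's Kohn–Luttinger source).
At `ω = ω′ = ω₀` these are p1's statements (`n(ω₀) = 0`).

Proofs are p1 g9's with the frequencies made variables and the carrier abstracted; exact identities only; nothing about sizes or physics.  0 kit.
-/

noncomputable section

namespace Summit.HubbardSuperconductivity.HubbardSuperconductivity.Theorems.KLRegimeWick

set_option linter.dupNamespace false -- summit = problem name (single-conjunct summit), D-0017

open Literature.MathematicalPhysics.QuantumLattice GrassmannAlgebra Finset Matrix
open Literature.Probability.LatticeModels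
open Summit.HubbardSuperconductivity.HubbardSuperconductivity.Theorems.TwoPointAssembly
open Summit.HubbardSuperconductivity.HubbardSuperconductivity.Theorems.KLProgrammeLegKernels
open Summit.HubbardSuperconductivity.HubbardSuperconductivity.Theorems.KLRegimeSplit

section Generic

variable {L M : ℕ} [NeZero L] [NeZero M] (β : ℝ) (W : HubbardGrassmann L M)

/-! ## §1 Selection rules at the particle–hole leg strings, general external frequencies -/

omit [NeZero L] [NeZero M] in
/-- **Charge selection at a particle–hole vertex** (external legs `ψ̂⁺, ψ̂⁻`): two line ends of EQUAL charge kill the kernel. -/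
theorem kernel_ph_same_charge_of_conserving
    (hWq : ∀ (m : ℕ) (X : Fin m → HubbardFieldIdx L M), (∑ i, (if (X i).2 = 0 then (1 : ℤ) else -1)) ≠ 0 → kernel ℂ W m X = 0)
    (p p' : FreqMomentum L M) (σ σ' c : Fin 2) (A B : FreqMomentum L M × Fin 2) :
    kernel ℂ W 4 ![((p, σ), c), ((p', σ'), c), (A, 0), (B, 1)] = 0 := by
  refine hWq 4 _ ?_
  fin_cases c <;> simp [Fin.sum_univ_four]

omit [NeZero L] [NeZero M] in
/-- **Selection at the DIRECT particle–hole vertex** `((ω′,k⃗′)↑+, (ω,k⃗)↑−)`: the line ends `ψ̂⁻_{pσ}, ψ̂⁺_{p′σ′}` carry the kernel only if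
`n(p′) + n(ω′) = n(p) + n(ω)`, `p⃗′ = p⃗ + k⃗ − k⃗′` and `σ′ = σ`. -/
theorem kernel_phd_eq_zero_of_not_of_conserving
    (hWf : ∀ (m : ℕ) (X : Fin m → HubbardFieldIdx L M),
      (∑ i, (if (X i).2 = 0 then (1 : ℤ) else -1) * matsubaraInt M (X i).1.1.1) ≠ 0 → kernel ℂ W m X = 0)
    (hWs : ∀ (m : ℕ) (X : Fin m → HubbardFieldIdx L M),
      (∑ i, (if (X i).2 = 0 then (1 : ℤ) else -1) * (if (X i).1.2 = 0 then 1 else 0)) ≠ 0 → kernel ℂ W m X = 0)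
    (hWp : ∀ (m : ℕ) (X : Fin m → HubbardFieldIdx L M) (j : Fin 2),
      (∑ i, (if (X i).2 = 0 then (1 : ℤ) else -1) • (X i).1.1.2 j) ≠ 0 → kernel ℂ W m X = 0)
    (k k' : TorusSite 2 L) (ω ω' : MatsubaraIdx M) (p p' : FreqMomentum L M) (σ σ' : Fin 2)
    (h : ¬(matsubaraInt M p'.1 + matsubaraInt M ω' = matsubaraInt M p.1 + matsubaraInt M ω ∧ p'.2 = p.2 + k - k' ∧ σ' = σ)) :
    kernel ℂ W 4 ![((p, σ), 1), ((p', σ'), 0), (((ω', k'), 0), 0), (((ω, k), 0), 1)] = 0 := by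
  by_cases hσ : σ' = σ
  · subst hσ
    by_cases hf : matsubaraInt M p'.1 + matsubaraInt M ω' = matsubaraInt M p.1 + matsubaraInt M ω
    · have hm : p'.2 ≠ p.2 + k - k' := fun h2 => h ⟨hf, h2, rfl⟩
      have : ∃ j : Fin 2, p'.2 j ≠ (p.2 + k - k') j := by
        by_contra hall
        push Not at hall
        exact hm (funext hall)
      obtain ⟨j, hj⟩ := this
      refine hWp 4 _ j ?_
      simp only [Fin.sum_univ_four, Matrix.cons_val_zero, Matrix.cons_val_one, Matrix.head_cons, Matrix.cons_val_two, Matrix.tail_cons,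
        Matrix.cons_val_three, Fin.isValue, if_true, one_ne_zero, if_false, one_smul, neg_smul]
      intro h0
      apply hj
      rw [Pi.sub_apply, Pi.add_apply]
      linear_combination h0
    · refine hWf 4 _ ?_
      simp only [Fin.sum_univ_four, Matrix.cons_val_zero, Matrix.cons_val_one, Matrix.head_cons, Matrix.cons_val_two, Matrix.tail_cons,
        Matrix.cons_val_three, Fin.isValue, if_true, one_ne_zero, if_false, one_mul, neg_mul]
      intro h0
      apply hf
      linarith
  · refine hWs 4 _ ?_
    fin_cases σ <;> fin_cases σ'
    · exact absurd rfl hσ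
    · simp [Fin.sum_univ_four]
    · simp [Fin.sum_univ_four]
    · exact absurd rfl hσ

omit [NeZero L] [NeZero M] in
/-- **Selection at the CROSSED particle–hole vertex** `((ω′,k⃗′)↑+, (−ω,Q−k⃗)↓−)`: the line ends `ψ̂⁻_{pσ}, ψ̂⁺_{p′σ′}` carry the kernel only if
`n(p′) + n(ω) + n(ω′) + 1 = n(p)`, `p⃗′ = p⃗ + Q − k⃗ − k⃗′` and `(σ, σ′) = (↑, ↓)`. -/
theorem kernel_phx_eq_zero_of_not_of_conserving
    (hWf : ∀ (m : ℕ) (X : Fin m → HubbardFieldIdx L M),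
      (∑ i, (if (X i).2 = 0 then (1 : ℤ) else -1) * matsubaraInt M (X i).1.1.1) ≠ 0 → kernel ℂ W m X = 0)
    (hWs : ∀ (m : ℕ) (X : Fin m → HubbardFieldIdx L M),
      (∑ i, (if (X i).2 = 0 then (1 : ℤ) else -1) * (if (X i).1.2 = 0 then 1 else 0)) ≠ 0 → kernel ℂ W m X = 0)
    (hWp : ∀ (m : ℕ) (X : Fin m → HubbardFieldIdx L M) (j : Fin 2),
      (∑ i, (if (X i).2 = 0 then (1 : ℤ) else -1) • (X i).1.1.2 j) ≠ 0 → kernel ℂ W m X = 0)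
    (Q k k' : TorusSite 2 L) (ω ω' : MatsubaraIdx M) (p p' : FreqMomentum L M) (σ σ' : Fin 2)
    (h : ¬(matsubaraInt M p'.1 + matsubaraInt M ω + matsubaraInt M ω' + 1 = matsubaraInt M p.1 ∧
        p'.2 = p.2 + Q - k - k' ∧ σ = 0 ∧ σ' = 1)) :
    kernel ℂ W 4 ![((p, σ), 1), ((p', σ'), 0), (((ω', k'), 0), 0), (((ω.rev, Q - k), 1), 1)] = 0 := by
  by_cases hs : σ = 0 ∧ σ' = 1
  · obtain ⟨rfl, rfl⟩ := hs
    by_cases hf : matsubaraInt M p'.1 + matsubaraInt M ω + matsubaraInt M ω' + 1 = matsubaraInt M p.1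
    · have hm : p'.2 ≠ p.2 + Q - k - k' := fun h2 => h ⟨hf, h2, rfl, rfl⟩
      have : ∃ j : Fin 2, p'.2 j ≠ (p.2 + Q - k - k') j := by
        by_contra hall
        push Not at hall
        exact hm (funext hall)
      obtain ⟨j, hj⟩ := this
      refine hWp 4 _ j ?_
      simp only [Fin.sum_univ_four, Matrix.cons_val_zero, Matrix.cons_val_one, Matrix.head_cons, Matrix.cons_val_two, Matrix.tail_cons,
        Matrix.cons_val_three, Fin.isValue, if_true, one_ne_zero, if_false, one_smul, neg_smul, Pi.sub_apply]
      intro h0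
      apply hj
      rw [Pi.sub_apply, Pi.sub_apply, Pi.add_apply]
      linear_combination h0
    · refine hWf 4 _ ?_
      simp only [Fin.sum_univ_four, Matrix.cons_val_zero, Matrix.cons_val_one, Matrix.head_cons, Matrix.cons_val_two, Matrix.tail_cons,
        Matrix.cons_val_three, Fin.isValue, if_true, one_ne_zero, if_false, one_mul, neg_mul, matsubaraInt_rev]
      intro h0
      apply hf
      linarith
  · refine hWs 4 _ ?_
    fin_cases σ <;> fin_cases σ'
    · simp [Fin.sum_univ_four]
    · exact absurd ⟨rfl, rfl⟩ hs
    · simp [Fin.sum_univ_four]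
    · simp [Fin.sum_univ_four]

/-! ## §2 The direct particle–hole channel, general external frequencies -/

omit [NeZero M] in
/-- **`bubbleSum_phDirect_pairKernel_of_conserving`** — the direct particle–hole channel sum of `kernel_dblFold_bubble_self` at the pair labels with
general external frequencies (`a`-legs `Z₀ = (ω′,k⃗′)↑+`, `Z₃ = (ω,k⃗)↑−`; `b`-legs `Z₁ = (−ω′,Q−k⃗′)↓+`, `Z₂ = (−ω,Q−k⃗)↓−`), diagonal lines, any
conserving carrier: the direct loop at transfer `(ω − ω′, k⃗ − k⃗′)`, conditional form. -/
theorem bubbleSum_phDirect_pairKernel_of_conserving (hβ : β ≠ 0)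
    (hWq : ∀ (m : ℕ) (X : Fin m → HubbardFieldIdx L M), (∑ i, (if (X i).2 = 0 then (1 : ℤ) else -1)) ≠ 0 → kernel ℂ W m X = 0)
    (hWf : ∀ (m : ℕ) (X : Fin m → HubbardFieldIdx L M),
      (∑ i, (if (X i).2 = 0 then (1 : ℤ) else -1) * matsubaraInt M (X i).1.1.1) ≠ 0 → kernel ℂ W m X = 0)
    (hWs : ∀ (m : ℕ) (X : Fin m → HubbardFieldIdx L M),
      (∑ i, (if (X i).2 = 0 then (1 : ℤ) else -1) * (if (X i).1.2 = 0 then 1 else 0)) ≠ 0 → kernel ℂ W m X = 0)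
    (hWp : ∀ (m : ℕ) (X : Fin m → HubbardFieldIdx L M) (j : Fin 2),
      (∑ i, (if (X i).2 = 0 then (1 : ℤ) else -1) • (X i).1.1.2 j) ≠ 0 → kernel ℂ W m X = 0)
    {C₁ C₂ : Matrix (HubbardFieldIdx L M) (HubbardFieldIdx L M) ℂ} {ℓ₁ ℓ₂ : FreqMomentum L M → ℂ}
    (h₁ : contr ℂ C₁ = diagContr L M ℓ₁) (h₂ : contr ℂ C₂ = diagContr L M ℓ₂) (Q : TorusSite 2 L) (x y : TorusSite 2 L × MatsubaraIdx M) :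
    ∑ X, ∑ Y, ∑ X', ∑ Y', contr ℂ C₂ X Y * contr ℂ C₁ X' Y' *
        (kernel ℂ W 4 ![X, X', (((y.2, y.1), 0), 0), (((x.2, x.1), 0), 1)] *
          kernel ℂ W 4 ![Y, Y', (((y.2.rev, Q - y.1), 1), 0), (((x.2.rev, Q - x.1), 1), 1)]) =
      -((((Nat.factorial 4 : ℝ) * (β * (L : ℝ) ^ 2) ^ 3 : ℝ) : ℂ)⁻¹ ^ 2 *
        ∑ p : FreqMomentum L M, ∑ σ : Fin 2, ∑ p' : FreqMomentum L M,
          if matsubaraInt M p'.1 + matsubaraInt M y.2 = matsubaraInt M p.1 + matsubaraInt M x.2 ∧ p'.2 = p.2 + x.1 - y.1 then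
            (ℓ₂ p * ℓ₁ p' + ℓ₁ p * ℓ₂ p') *
              (vertexFn L M β W 4 ![((p, σ), 1), ((p', σ), 0), (((y.2, y.1), 0), 0), (((x.2, x.1), 0), 1)] *
                vertexFn L M β W 4 ![((p, σ), 0), ((p', σ), 1), (((y.2.rev, Q - y.1), 1), 0), (((x.2.rev, Q - x.1), 1), 1)])
          else 0) := by
  set Z₀ : HubbardFieldIdx L M := (((y.2, y.1), 0), 0) with hZ₀
  set Z₃ : HubbardFieldIdx L M := (((x.2, x.1), 0), 1) with hZ₃
  set Z₁ : HubbardFieldIdx L M := (((y.2.rev, Q - y.1), 1), 0) with hZ₁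
  set Z₂ : HubbardFieldIdx L M := (((x.2.rev, Q - x.1), 1), 1) with hZ₂
  -- Step 1: line reductions
  rw [h₁, h₂]
  simp_rw [mul_assoc, ← Finset.mul_sum]
  rw [sum_diagContr_mul]
  simp_rw [sum_diagContr_mul]
  -- Step 2: charge conservation at the `a`-vertex (legs `ψ̂⁺ψ̂⁻`): equal-charge line ends die
  have hv : ∀ (p p' : FreqMomentum L M) (σ σ' c : Fin 2), kernel ℂ W 4 ![((p, σ), c), ((p', σ'), c), Z₀, Z₃] = 0 :=
    fun p p' σ σ' c => kernel_ph_same_charge_of_conserving W hWq p p' σ σ' c _ _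
  simp only [hv, zero_mul, sub_zero, zero_sub, mul_neg, Finset.sum_neg_distrib, Finset.mul_sum]
  -- Step 3: merge the two orientation terms
  have hB : ∑ p : FreqMomentum L M, ∑ σ : Fin 2, ∑ p' : FreqMomentum L M, ∑ σ' : Fin 2, ℓ₂ p * (ℓ₁ p' *
        (kernel ℂ W 4 ![((p, σ), 0), ((p', σ'), 1), Z₀, Z₃] * kernel ℂ W 4 ![((p, σ), 1), ((p', σ'), 0), Z₁, Z₂])) =
      ∑ p : FreqMomentum L M, ∑ σ : Fin 2, ∑ p' : FreqMomentum L M, ∑ σ' : Fin 2, ℓ₂ p' * (ℓ₁ p *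
        (kernel ℂ W 4 ![((p, σ), 1), ((p', σ'), 0), Z₀, Z₃] * kernel ℂ W 4 ![((p, σ), 0), ((p', σ'), 1), Z₁, Z₂])) := by
    rw [sum_swap_pairs]
    refine Finset.sum_congr rfl fun p _ => Finset.sum_congr rfl fun σ _ => Finset.sum_congr rfl fun p' _ =>
      Finset.sum_congr rfl fun σ' _ => ?_
    rw [kernel_four_swap01 W ((p, σ), 1) ((p', σ'), 0), kernel_four_swap01 W ((p, σ), 0) ((p', σ'), 1)]
    ring
  -- Step 4: conservation at the `a`-vertex: `σ′ = σ`, frequency shifted by `n(ω) − n(ω′)`, momentum by `k − k′`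
  have hcons : ∀ (p : FreqMomentum L M) (σ : Fin 2) (g : FreqMomentum L M → FreqMomentum L M → ℂ),
      ∑ p' : FreqMomentum L M, ∑ σ' : Fin 2, g p p' *
        (kernel ℂ W 4 ![((p, σ), 1), ((p', σ'), 0), Z₀, Z₃] * kernel ℂ W 4 ![((p, σ), 0), ((p', σ'), 1), Z₁, Z₂]) =
      ∑ p' : FreqMomentum L M,
        if matsubaraInt M p'.1 + matsubaraInt M y.2 = matsubaraInt M p.1 + matsubaraInt M x.2 ∧ p'.2 = p.2 + x.1 - y.1 then
          g p p' * (kernel ℂ W 4 ![((p, σ), 1), ((p', σ), 0), Z₀, Z₃] * kernel ℂ W 4 ![((p, σ), 0), ((p', σ), 1), Z₁, Z₂]) else 0 := by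
    intro p σ g
    have hz : ∀ (p' : FreqMomentum L M) (σ' : Fin 2),
        ¬(matsubaraInt M p'.1 + matsubaraInt M y.2 = matsubaraInt M p.1 + matsubaraInt M x.2 ∧ p'.2 = p.2 + x.1 - y.1 ∧ σ' = σ) →
          kernel ℂ W 4 ![((p, σ), 1), ((p', σ'), 0), Z₀, Z₃] = 0 :=
      fun p' σ' h => kernel_phd_eq_zero_of_not_of_conserving W hWf hWs hWp x.1 y.1 x.2 y.2 p p' σ σ' h
    refine Finset.sum_congr rfl fun p' _ => ?_
    rw [Fintype.sum_eq_single σ (fun σ' hσ' => by rw [hz p' σ' (fun h => hσ' h.2.2), zero_mul, mul_zero])]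
    by_cases hc : matsubaraInt M p'.1 + matsubaraInt M y.2 = matsubaraInt M p.1 + matsubaraInt M x.2 ∧ p'.2 = p.2 + x.1 - y.1
    · rw [if_pos hc]
    · rw [if_neg hc, hz p' σ (fun h => hc ⟨h.1, h.2.1⟩), zero_mul, mul_zero]
  have hmerge : ∀ (p : FreqMomentum L M) (σ : Fin 2),
      -(∑ p' : FreqMomentum L M, ∑ σ' : Fin 2, ℓ₂ p * (ℓ₁ p' *
          (kernel ℂ W 4 ![((p, σ), 1), ((p', σ'), 0), Z₀, Z₃] * kernel ℂ W 4 ![((p, σ), 0), ((p', σ'), 1), Z₁, Z₂]))) -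
        ∑ p' : FreqMomentum L M, ∑ σ' : Fin 2, ℓ₂ p' * (ℓ₁ p *
          (kernel ℂ W 4 ![((p, σ), 1), ((p', σ'), 0), Z₀, Z₃] * kernel ℂ W 4 ![((p, σ), 0), ((p', σ'), 1), Z₁, Z₂])) =
      -(∑ p' : FreqMomentum L M,
        if matsubaraInt M p'.1 + matsubaraInt M y.2 = matsubaraInt M p.1 + matsubaraInt M x.2 ∧ p'.2 = p.2 + x.1 - y.1 then
          (ℓ₂ p * ℓ₁ p' + ℓ₁ p * ℓ₂ p') *
            (kernel ℂ W 4 ![((p, σ), 1), ((p', σ), 0), Z₀, Z₃] * kernel ℂ W 4 ![((p, σ), 0), ((p', σ), 1), Z₁, Z₂]) else 0) := by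
    intro p σ
    rw [← hcons p σ (fun p p' => ℓ₂ p * ℓ₁ p' + ℓ₁ p * ℓ₂ p'), ← neg_add', ← Finset.sum_add_distrib]
    congr 1
    refine Finset.sum_congr rfl fun p' _ => ?_
    rw [← Finset.sum_add_distrib]
    refine Finset.sum_congr rfl fun σ' _ => ?_
    ring
  -- assemble
  have hL : ∑ p : FreqMomentum L M, ∑ σ : Fin 2, ℓ₂ p *
        (-(∑ p' : FreqMomentum L M, ∑ σ' : Fin 2, ℓ₁ p' *
            (kernel ℂ W 4 ![((p, σ), 1), ((p', σ'), 0), Z₀, Z₃] * kernel ℂ W 4 ![((p, σ), 0), ((p', σ'), 1), Z₁, Z₂])) -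
          ∑ p' : FreqMomentum L M, ∑ σ' : Fin 2, ℓ₁ p' *
            (kernel ℂ W 4 ![((p, σ), 0), ((p', σ'), 1), Z₀, Z₃] * kernel ℂ W 4 ![((p, σ), 1), ((p', σ'), 0), Z₁, Z₂])) =
      -(∑ p : FreqMomentum L M, ∑ σ : Fin 2, ∑ p' : FreqMomentum L M, ∑ σ' : Fin 2, ℓ₂ p * (ℓ₁ p' *
            (kernel ℂ W 4 ![((p, σ), 1), ((p', σ'), 0), Z₀, Z₃] * kernel ℂ W 4 ![((p, σ), 0), ((p', σ'), 1), Z₁, Z₂]))) -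
        ∑ p : FreqMomentum L M, ∑ σ : Fin 2, ∑ p' : FreqMomentum L M, ∑ σ' : Fin 2, ℓ₂ p * (ℓ₁ p' *
            (kernel ℂ W 4 ![((p, σ), 0), ((p', σ'), 1), Z₀, Z₃] * kernel ℂ W 4 ![((p, σ), 1), ((p', σ'), 0), Z₁, Z₂])) := by
    rw [← neg_add', ← Finset.sum_add_distrib, ← Finset.sum_neg_distrib]
    refine Finset.sum_congr rfl fun p _ => ?_
    rw [← Finset.sum_add_distrib, ← Finset.sum_neg_distrib]
    refine Finset.sum_congr rfl fun σ _ => ?_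
    rw [neg_add', mul_sub, mul_neg, Finset.mul_sum, Finset.mul_sum]
    simp only [Finset.mul_sum]
  rw [hL, hB]
  conv_rhs => rw [← Finset.sum_neg_distrib]
  rw [← Finset.sum_neg_distrib, ← Finset.sum_sub_distrib]
  refine Finset.sum_congr rfl fun p _ => ?_
  conv_rhs => rw [← Finset.sum_neg_distrib]
  rw [← Finset.sum_neg_distrib, ← Finset.sum_sub_distrib]
  refine Finset.sum_congr rfl fun σ _ => ?_
  rw [hmerge p σ, neg_inj]
  refine Finset.sum_congr rfl fun p' _ => ?_
  split_ifs
  · rw [kernel_four_eq_inv_mul_vertexFn β hβ W, kernel_four_eq_inv_mul_vertexFn β hβ W]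
    ring
  · ring

/-! ## §3 The crossed particle–hole channel, general external frequencies -/

omit [NeZero M] in
/-- **`bubbleSum_phCrossed_pairKernel_of_conserving`** — the crossed particle–hole channel sum of `kernel_dblFold_bubble_self` at the pair labels with
general external frequencies (`a`-legs `Z₀ = (ω′,k⃗′)↑+`, `Z₂ = (−ω,Q−k⃗)↓−`; `b`-legs `Z₁ = (−ω′,Q−k⃗′)↓+`, `Z₃ = (ω,k⃗)↑−`), diagonal lines, any
conserving carrier: ONE exchange loop, spins forced `(↑,↓)`, second line at `n(p′) = n(p) − n(ω) − n(ω′) − 1`, `p⃗′ = p⃗ + Q − k⃗ − k⃗′`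
(conditional form, empty at the finite-`M` edge). -/
theorem bubbleSum_phCrossed_pairKernel_of_conserving (hβ : β ≠ 0)
    (hWq : ∀ (m : ℕ) (X : Fin m → HubbardFieldIdx L M), (∑ i, (if (X i).2 = 0 then (1 : ℤ) else -1)) ≠ 0 → kernel ℂ W m X = 0)
    (hWf : ∀ (m : ℕ) (X : Fin m → HubbardFieldIdx L M),
      (∑ i, (if (X i).2 = 0 then (1 : ℤ) else -1) * matsubaraInt M (X i).1.1.1) ≠ 0 → kernel ℂ W m X = 0)
    (hWs : ∀ (m : ℕ) (X : Fin m → HubbardFieldIdx L M),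
      (∑ i, (if (X i).2 = 0 then (1 : ℤ) else -1) * (if (X i).1.2 = 0 then 1 else 0)) ≠ 0 → kernel ℂ W m X = 0)
    (hWp : ∀ (m : ℕ) (X : Fin m → HubbardFieldIdx L M) (j : Fin 2),
      (∑ i, (if (X i).2 = 0 then (1 : ℤ) else -1) • (X i).1.1.2 j) ≠ 0 → kernel ℂ W m X = 0)
    {C₁ C₂ : Matrix (HubbardFieldIdx L M) (HubbardFieldIdx L M) ℂ} {ℓ₁ ℓ₂ : FreqMomentum L M → ℂ}
    (h₁ : contr ℂ C₁ = diagContr L M ℓ₁) (h₂ : contr ℂ C₂ = diagContr L M ℓ₂) (Q : TorusSite 2 L) (x y : TorusSite 2 L × MatsubaraIdx M) :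
    ∑ X, ∑ Y, ∑ X', ∑ Y', contr ℂ C₂ X Y * contr ℂ C₁ X' Y' *
        (kernel ℂ W 4 ![X, X', (((y.2, y.1), 0), 0), (((x.2.rev, Q - x.1), 1), 1)] *
          kernel ℂ W 4 ![Y, Y', (((y.2.rev, Q - y.1), 1), 0), (((x.2, x.1), 0), 1)]) =
      -((((Nat.factorial 4 : ℝ) * (β * (L : ℝ) ^ 2) ^ 3 : ℝ) : ℂ)⁻¹ ^ 2 *
        ∑ p : FreqMomentum L M, ∑ p' : FreqMomentum L M,
          if matsubaraInt M p'.1 + matsubaraInt M x.2 + matsubaraInt M y.2 + 1 = matsubaraInt M p.1 ∧ p'.2 = p.2 + Q - x.1 - y.1 then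
            (ℓ₂ p * ℓ₁ p' + ℓ₁ p * ℓ₂ p') *
              (vertexFn L M β W 4 ![((p, 0), 1), ((p', 1), 0), (((y.2, y.1), 0), 0), (((x.2.rev, Q - x.1), 1), 1)] *
                vertexFn L M β W 4 ![((p, 0), 0), ((p', 1), 1), (((y.2.rev, Q - y.1), 1), 0), (((x.2, x.1), 0), 1)])
          else 0) := by
  set Z₀ : HubbardFieldIdx L M := (((y.2, y.1), 0), 0) with hZ₀
  set Z₂ : HubbardFieldIdx L M := (((x.2.rev, Q - x.1), 1), 1) with hZ₂
  set Z₁ : HubbardFieldIdx L M := (((y.2.rev, Q - y.1), 1), 0) with hZ₁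
  set Z₃ : HubbardFieldIdx L M := (((x.2, x.1), 0), 1) with hZ₃
  -- Step 1: line reductions
  rw [h₁, h₂]
  simp_rw [mul_assoc, ← Finset.mul_sum]
  rw [sum_diagContr_mul]
  simp_rw [sum_diagContr_mul]
  -- Step 2: charge conservation at the `a`-vertex (legs `ψ̂⁺ψ̂⁻`)
  have hv : ∀ (p p' : FreqMomentum L M) (σ σ' c : Fin 2), kernel ℂ W 4 ![((p, σ), c), ((p', σ'), c), Z₀, Z₂] = 0 :=
    fun p p' σ σ' c => kernel_ph_same_charge_of_conserving W hWq p p' σ σ' c _ _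
  simp only [hv, zero_mul, sub_zero, zero_sub, mul_neg, Finset.sum_neg_distrib, Finset.mul_sum]
  -- Step 3: merge the two orientation terms
  have hB : ∑ p : FreqMomentum L M, ∑ σ : Fin 2, ∑ p' : FreqMomentum L M, ∑ σ' : Fin 2, ℓ₂ p * (ℓ₁ p' *
        (kernel ℂ W 4 ![((p, σ), 0), ((p', σ'), 1), Z₀, Z₂] * kernel ℂ W 4 ![((p, σ), 1), ((p', σ'), 0), Z₁, Z₃])) =
      ∑ p : FreqMomentum L M, ∑ σ : Fin 2, ∑ p' : FreqMomentum L M, ∑ σ' : Fin 2, ℓ₂ p' * (ℓ₁ p *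
        (kernel ℂ W 4 ![((p, σ), 1), ((p', σ'), 0), Z₀, Z₂] * kernel ℂ W 4 ![((p, σ), 0), ((p', σ'), 1), Z₁, Z₃])) := by
    rw [sum_swap_pairs]
    refine Finset.sum_congr rfl fun p _ => Finset.sum_congr rfl fun σ _ => Finset.sum_congr rfl fun p' _ =>
      Finset.sum_congr rfl fun σ' _ => ?_
    rw [kernel_four_swap01 W ((p, σ), 1) ((p', σ'), 0), kernel_four_swap01 W ((p, σ), 0) ((p', σ'), 1)]
    ring
  -- Step 4: conservation at the `a`-vertex: spins `(↑, ↓)`, frequency lowered, momentum shifted by `Q − k − k′`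
  have hcons : ∀ (p : FreqMomentum L M) (g : FreqMomentum L M → FreqMomentum L M → ℂ),
      ∑ σ : Fin 2, ∑ p' : FreqMomentum L M, ∑ σ' : Fin 2, g p p' *
        (kernel ℂ W 4 ![((p, σ), 1), ((p', σ'), 0), Z₀, Z₂] * kernel ℂ W 4 ![((p, σ), 0), ((p', σ'), 1), Z₁, Z₃]) =
      ∑ p' : FreqMomentum L M,
        if matsubaraInt M p'.1 + matsubaraInt M x.2 + matsubaraInt M y.2 + 1 = matsubaraInt M p.1 ∧ p'.2 = p.2 + Q - x.1 - y.1 then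
        g p p' * (kernel ℂ W 4 ![((p, 0), 1), ((p', 1), 0), Z₀, Z₂] * kernel ℂ W 4 ![((p, 0), 0), ((p', 1), 1), Z₁, Z₃]) else 0 := by
    intro p g
    have hz : ∀ (p' : FreqMomentum L M) (σ σ' : Fin 2),
        ¬(matsubaraInt M p'.1 + matsubaraInt M x.2 + matsubaraInt M y.2 + 1 = matsubaraInt M p.1 ∧ p'.2 = p.2 + Q - x.1 - y.1 ∧
            σ = 0 ∧ σ' = 1) →
          kernel ℂ W 4 ![((p, σ), 1), ((p', σ'), 0), Z₀, Z₂] = 0 :=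
      fun p' σ σ' h => kernel_phx_eq_zero_of_not_of_conserving W hWf hWs hWp Q x.1 y.1 x.2 y.2 p p' σ σ' h
    rw [Finset.sum_comm]
    refine Finset.sum_congr rfl fun p' _ => ?_
    simp only [Fin.sum_univ_two, Fin.isValue]
    rw [hz p' 0 0 (by simp), hz p' 1 0 (by simp), hz p' 1 1 (by simp)]
    by_cases hc : matsubaraInt M p'.1 + matsubaraInt M x.2 + matsubaraInt M y.2 + 1 = matsubaraInt M p.1 ∧ p'.2 = p.2 + Q - x.1 - y.1
    · rw [if_pos hc]; ring
    · rw [if_neg hc, hz p' 0 1 (fun h => hc ⟨h.1, h.2.1⟩)]; ring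
  have hmerge : ∀ p : FreqMomentum L M,
      ∑ σ : Fin 2, (-(∑ p' : FreqMomentum L M, ∑ σ' : Fin 2, ℓ₂ p * (ℓ₁ p' *
          (kernel ℂ W 4 ![((p, σ), 1), ((p', σ'), 0), Z₀, Z₂] * kernel ℂ W 4 ![((p, σ), 0), ((p', σ'), 1), Z₁, Z₃]))) -
        ∑ p' : FreqMomentum L M, ∑ σ' : Fin 2, ℓ₂ p' * (ℓ₁ p *
          (kernel ℂ W 4 ![((p, σ), 1), ((p', σ'), 0), Z₀, Z₂] * kernel ℂ W 4 ![((p, σ), 0), ((p', σ'), 1), Z₁, Z₃]))) =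
      -(∑ p' : FreqMomentum L M,
        if matsubaraInt M p'.1 + matsubaraInt M x.2 + matsubaraInt M y.2 + 1 = matsubaraInt M p.1 ∧ p'.2 = p.2 + Q - x.1 - y.1 then
        (ℓ₂ p * ℓ₁ p' + ℓ₁ p * ℓ₂ p') *
          (kernel ℂ W 4 ![((p, 0), 1), ((p', 1), 0), Z₀, Z₂] * kernel ℂ W 4 ![((p, 0), 0), ((p', 1), 1), Z₁, Z₃]) else 0) := by
    intro p
    rw [← hcons p (fun p p' => ℓ₂ p * ℓ₁ p' + ℓ₁ p * ℓ₂ p'), ← Finset.sum_neg_distrib]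
    refine Finset.sum_congr rfl fun σ _ => ?_
    rw [← neg_add', ← Finset.sum_add_distrib]
    congr 1
    refine Finset.sum_congr rfl fun p' _ => ?_
    rw [← Finset.sum_add_distrib]
    refine Finset.sum_congr rfl fun σ' _ => ?_
    ring
  -- assemble
  have hL : ∑ p : FreqMomentum L M, ∑ σ : Fin 2, ℓ₂ p *
        (-(∑ p' : FreqMomentum L M, ∑ σ' : Fin 2, ℓ₁ p' *
            (kernel ℂ W 4 ![((p, σ), 1), ((p', σ'), 0), Z₀, Z₂] * kernel ℂ W 4 ![((p, σ), 0), ((p', σ'), 1), Z₁, Z₃])) -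
          ∑ p' : FreqMomentum L M, ∑ σ' : Fin 2, ℓ₁ p' *
            (kernel ℂ W 4 ![((p, σ), 0), ((p', σ'), 1), Z₀, Z₂] * kernel ℂ W 4 ![((p, σ), 1), ((p', σ'), 0), Z₁, Z₃])) =
      -(∑ p : FreqMomentum L M, ∑ σ : Fin 2, ∑ p' : FreqMomentum L M, ∑ σ' : Fin 2, ℓ₂ p * (ℓ₁ p' *
            (kernel ℂ W 4 ![((p, σ), 1), ((p', σ'), 0), Z₀, Z₂] * kernel ℂ W 4 ![((p, σ), 0), ((p', σ'), 1), Z₁, Z₃]))) -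
        ∑ p : FreqMomentum L M, ∑ σ : Fin 2, ∑ p' : FreqMomentum L M, ∑ σ' : Fin 2, ℓ₂ p * (ℓ₁ p' *
            (kernel ℂ W 4 ![((p, σ), 0), ((p', σ'), 1), Z₀, Z₂] * kernel ℂ W 4 ![((p, σ), 1), ((p', σ'), 0), Z₁, Z₃])) := by
    rw [← neg_add', ← Finset.sum_add_distrib, ← Finset.sum_neg_distrib]
    refine Finset.sum_congr rfl fun p _ => ?_
    rw [← Finset.sum_add_distrib, ← Finset.sum_neg_distrib]
    refine Finset.sum_congr rfl fun σ _ => ?_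
    rw [neg_add', mul_sub, mul_neg, Finset.mul_sum, Finset.mul_sum]
    simp only [Finset.mul_sum]
  rw [hL, hB]
  conv_rhs => rw [← Finset.sum_neg_distrib]
  rw [← Finset.sum_neg_distrib, ← Finset.sum_sub_distrib]
  refine Finset.sum_congr rfl fun p _ => ?_
  rw [← Finset.sum_neg_distrib, ← Finset.sum_sub_distrib, hmerge p, neg_inj]
  refine Finset.sum_congr rfl fun p' _ => ?_
  split_ifs
  · rw [kernel_four_eq_inv_mul_vertexFn β hβ W, kernel_four_eq_inv_mul_vertexFn β hβ W]
    ring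
  · ring

end Generic

end Summit.HubbardSuperconductivity.HubbardSuperconductivity.Theorems.KLRegimeWick

end
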